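import Summits.QuantumFields.YangMills.Theorems.UnitScaleTiltProp7CompactChart
import Summits.QuantumFields.YangMills.Theorems.UnitScaleTiltMinimiserStabilityRegPrAvgActionDefect
import Summits.QuantumFields.YangMills.Theorems.UnitScaleTiltProp8GaugeCurrent
import Literature.MathematicalPhysics.QuantumFieldTheory.Balaban1983to89.B6AvgWeightsKLevelV1
import HarnessLib

/-!
# Route `UnitScaleTilt`, crux K1 «MinimiserStabilityRegPr» (stmt-QuantumFields-19200), registered stub `stub_prop7From14` (leaf V3 «Prop 7 from a
# background (14)») — **THE SLICE EQUATION OF THE `ℓ²`-OPTIMAL CHART: at every site off the block centres the optimal (4)-representative `W` of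
# `Prop7CompactChart` satisfies the EXACT local optimality `Re Tr(c·𝒥_x) ≤ Re Tr 𝒥_x` for all `c ∈ SU(2)`, `𝒥_x = Σ_{b₋=x} W_bU_b^* + Σ_{b₊=x}(U_b^*W_b)^*`,
# and its infinitesimal form `Re Tr(X·𝒥_x) = 0` for `X ∈ 𝔰𝔲(2)` — the lattice LANDAU GAUGE RELATIVE TO THE BACKGROUND `U`, imposed OFF the centres**

Cell `ym3-torus` ∕ fleet seat `ym-ust-19200-p1` (gen 6); CARD-g6 successor spec 0.  `Prop7CompactChart.exists_optimalRepr` gives, for any `U`, `W′`, a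
representative `W` of the (4)-orbit of `W′` minimising `Φ_U(W) = Σ_b‖W_bU_b⁻¹ − 1‖²` over the group (4) (`u = 1` at the `(K−n)`-fold centres).  Here the
minimality is localised: varying `u` at ONE non-centre site `x` by `c ∈ SU(2)` stays inside (4) (§1), changes `Φ_U` only through the `2d` bonds at `x`, and
— with `‖V − 1‖² = 2 − Re Tr V` on `SU(2)` (`AvgActionDefect.one_sub_reTr_eq_half_dist1_sq_su2`) — by the amount `−Re Tr((c − 1)·J₁) − Re Tr((c^* − 1)·J₂)`,
`J₁ = Σ_μ W(x,μ)U(x,μ)^*`, `J₂ = Σ_μ U(x−e_μ,μ)^*W(x−e_μ,μ)` (§2, `sum_normSq_pertVar_siteUpdate_sub`).  Hence (§3) **`optimalRepr_site_ineq`**: the exact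
variational inequality at every non-centre site against ALL of `SU(2)`; and (§4) along the one-parameter subgroups `t ↦ exp(tX)`, `X` skew-Hermitian traceless
(`Prop8Criticality.exp_smul_mem_su2`), the first-order condition **`optimalRepr_site_stationary`**: `Re Tr(X·J₁) = Re Tr(X·J₂)` for every `X ∈ 𝔰𝔲(2)` — i.e.
the `𝔰𝔲(2)`-projection of the backward covariant divergence `Σ_{b₋=x} Y_b − Σ_{b₊=x} U_b^*Y_bU_b` of `Y = WU^* − 1` vanishes at every `x` off the centres
(the «point-Landau» slice; at the centres there is no condition, the group (4) being trivial there).  This is the slice on which CARD-g6's (G)-opt coercivity is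
to be proved.  Sorry-free, no definitions; nothing of Bałaban's analysis is used.

References: T. Bałaban, CMP 102 (1985) 277–309 [Balaban1985Variational] ((4) p.278, (16)–(21) pp.280–281); CMP 99 (1985) 75–102 [Balaban1985RegularSpaces]
((1.14), (1.19)–(1.20) pp.78–79, (1.38) p.82); I. Montvay, G. Münster, *Quantum fields on a lattice* (1994) §4.2 [MontvayMunster1994].
-/

noncomputable section

namespace Summit.QuantumFields.YangMills.Theorems.Prop7OptimalSlice

open scoped BigOperators Matrix.Norms.L2Operator Matrix Topology
open Filter NormedSpace
open Literature.MathematicalPhysics.QuantumFieldTheory.Balaban1983to89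
open T4Continuum B15DeterminingSets
open Literature.MathematicalPhysics.QuantumFieldTheory.Balaban1983to89.T3ContinuumYM3Torus
open Literature.MathematicalPhysics.QuantumFieldTheory.Balaban1983to89.T3PrintedRegularOrbits (descTransf)
open BlockAveragingEMLLinearisedBackground (pertVar pertVar_eq)
open Summit.QuantumFields.YangMills.Theorems.Prop7CompactChart (descTransf_eq_one_iff norm_pertVar_eq_dist1)
open Summit.QuantumFields.YangMills.Theorems.AvgActionDefect (one_sub_reTr_eq_half_dist1_sq_su2)

variable {P : Params}

/-! ## §1 One-site variations inside the group (4) -/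

/-- `x − e_μ ≠ x` (`1 ≠ 0` among the site labels, `B6AvgWeightsKLevelV1.one_ne_zero_sites`; the forward twin `x + e_μ ≠ x` is the tree's
`N21ThresholdMixtureRStepLocalityRaw.site_shift_ne_self`, re-derived inline below to keep the import cone small). [folklore] -/
theorem unshift_ne_self {j : ℕ} (x : Site P j) (μ : Fin P.d) : x.unshift μ ≠ x := by
  intro h
  have h1 := congrFun h μ
  rw [Site.unshift_apply, if_pos rfl] at h1
  exact B6AvgWeightsKLevelV1.one_ne_zero_sites j (sub_eq_self.mp h1)

variable (F : T3Family) {n K : ℕ} (h : n ≤ K)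

/-- **A ONE-SITE VARIATION OFF THE CENTRES LIES IN THE GROUP (4)**: `u_c = c` at `x`, `1` elsewhere, `x` not a `(K−n)`-fold centre ⇒ `u_c↓ = 1`.
[cite: Balaban1985Variational, (4) p.278] -/
theorem descTransf_update_one {x : Site (F.P K) 0} (hx : ∀ y : Site (F.P K) (K - n), embIter (K - n) y ≠ x) (c : Matrix.specialUnitaryGroup (Fin 2) ℂ) :
    descTransf F n K h (Function.update (fun _ : Site (F.P K) 0 => (1 : Matrix.specialUnitaryGroup (Fin 2) ℂ)) x c) = fun _ => 1 :=
  (descTransf_eq_one_iff F h _).mpr fun y => by rw [Function.update_of_ne (hx y)]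

/-! ## §2 The change of `Φ_U` under a one-site variation -/

/-- `‖W_bU_b⁻¹ − 1‖² = 2 − Re Tr(W_bU_b^*)` on `SU(2)` (operator norm; [Balaban1987RG1] (0.14) as an identity, via
`AvgActionDefect.one_sub_reTr_eq_half_dist1_sq_su2`). [cite: Balaban1987RG1, (0.14) p.254] -/
theorem normSq_pertVar_eq {j : ℕ} (U W : GaugeField P j (Matrix.specialUnitaryGroup (Fin 2) ℂ)) (b : PBond P j) :
    ‖pertVar U W b‖ ^ 2 = 2 - (((W b : Matrix (Fin 2) (Fin 2) ℂ) * star (U b : Matrix (Fin 2) (Fin 2) ℂ)).trace).re := by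
  have h1 := one_sub_reTr_eq_half_dist1_sq_su2 (W b * (U b)⁻¹)
  have h2 : reTr (W b * (U b)⁻¹) = (((W b * (U b)⁻¹ : Matrix.specialUnitaryGroup (Fin 2) ℂ) : Matrix (Fin 2) (Fin 2) ℂ).trace.re) /
      (Fintype.card (Fin 2) : ℝ) := rfl
  have h3 : ((W b * (U b)⁻¹ : Matrix.specialUnitaryGroup (Fin 2) ℂ) : Matrix (Fin 2) (Fin 2) ℂ) =
      (W b : Matrix (Fin 2) (Fin 2) ℂ) * star (U b : Matrix (Fin 2) (Fin 2) ℂ) := by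
    have h := pertVar_eq U W b
    unfold pertVar at h
    exact sub_left_injective h
  rw [Fintype.card_fin, Nat.cast_ofNat, h3] at h2
  rw [h2] at h1
  rw [norm_pertVar_eq_dist1]
  linarith

/-- **THE CHANGE OF `Φ_U(W) = Σ_b‖W_bU_b⁻¹ − 1‖²` UNDER THE ONE-SITE VARIATION `u_c` AT `x`**: only the `2d` bonds at `x` move, and
`Φ_U(W^{u_c}) − Φ_U(W) = −Σ_μ Re Tr((c − 1)·W(x,μ)U(x,μ)^*) − Σ_μ Re Tr((c^* − 1)·U(x−e_μ,μ)^*W(x−e_μ,μ))`. [folklore] -/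
theorem sum_normSq_pertVar_siteUpdate_sub {j : ℕ} (U W : GaugeField P j (Matrix.specialUnitaryGroup (Fin 2) ℂ)) (x : Site P j)
    (c : Matrix.specialUnitaryGroup (Fin 2) ℂ) :
    ∑ b : PBond P j, ‖pertVar U (GaugeField.gaugeAct (Function.update (fun _ : Site P j => (1 : Matrix.specialUnitaryGroup (Fin 2) ℂ)) x c) W) b‖ ^ 2
      - ∑ b : PBond P j, ‖pertVar U W b‖ ^ 2 =
      -(∑ μ : Fin P.d, ((((c : Matrix (Fin 2) (Fin 2) ℂ) - 1) * ((W ⟨x, μ⟩ : Matrix (Fin 2) (Fin 2) ℂ) * star (U ⟨x, μ⟩ : Matrix (Fin 2) (Fin 2) ℂ))).trace).re)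
      - ∑ μ : Fin P.d, (((star (c : Matrix (Fin 2) (Fin 2) ℂ) - 1) *
          (star (U ⟨x.unshift μ, μ⟩ : Matrix (Fin 2) (Fin 2) ℂ) * (W ⟨x.unshift μ, μ⟩ : Matrix (Fin 2) (Fin 2) ℂ))).trace).re := by
  classical
  set u : GaugeTransf P j (Matrix.specialUnitaryGroup (Fin 2) ℂ) :=
    Function.update (fun _ : Site P j => (1 : Matrix.specialUnitaryGroup (Fin 2) ℂ)) x c with hu
  have hux : u x = c := by rw [hu, Function.update_self]
  have hune : ∀ {y : Site P j}, y ≠ x → u y = 1 := fun hy => by rw [hu, Function.update_of_ne hy]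
  -- abbreviations for the two local currents
  set a : Fin P.d → ℝ := fun μ =>
    ((((c : Matrix (Fin 2) (Fin 2) ℂ) - 1) * ((W ⟨x, μ⟩ : Matrix (Fin 2) (Fin 2) ℂ) * star (U ⟨x, μ⟩ : Matrix (Fin 2) (Fin 2) ℂ))).trace).re with ha
  set a' : Fin P.d → ℝ := fun μ =>
    (((star (c : Matrix (Fin 2) (Fin 2) ℂ) - 1) *
      (star (U ⟨x.unshift μ, μ⟩ : Matrix (Fin 2) (Fin 2) ℂ) * (W ⟨x.unshift μ, μ⟩ : Matrix (Fin 2) (Fin 2) ℂ))).trace).re with ha'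
  show _ = -(∑ μ : Fin P.d, a μ) - ∑ μ : Fin P.d, a' μ
  -- the bond sums as sums over (source, direction)
  have hsum : ∀ f : PBond P j → ℝ, ∑ b : PBond P j, f b = ∑ s : Site P j, ∑ μ : Fin P.d, f ⟨s, μ⟩ := fun f => by
    rw [← Fintype.sum_prod_type']
    exact (Fintype.sum_equiv (⟨fun p => ⟨p.1, p.2⟩, fun b => (b.src, b.dir), fun _ => rfl, fun _ => rfl⟩ : Site P j × Fin P.d ≃ PBond P j)
      (fun p : Site P j × Fin P.d => f ⟨p.1, p.2⟩) f fun _ => rfl).symm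
  -- per bond: the difference is supported on the `2d` bonds at `x`
  have hcoe : ∀ (s : Site P j) (μ : Fin P.d),
      ((GaugeField.gaugeAct u W ⟨s, μ⟩ : Matrix.specialUnitaryGroup (Fin 2) ℂ) : Matrix (Fin 2) (Fin 2) ℂ) =
        (u s : Matrix (Fin 2) (Fin 2) ℂ) * (W ⟨s, μ⟩ : Matrix (Fin 2) (Fin 2) ℂ) * star (u (s.shift μ) : Matrix (Fin 2) (Fin 2) ℂ) := fun s μ => by
    show (((u s * W ⟨s, μ⟩ * (u (s.shift μ))⁻¹ : Matrix.specialUnitaryGroup (Fin 2) ℂ)) : Matrix (Fin 2) (Fin 2) ℂ) = _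
    rw [Submonoid.coe_mul, Submonoid.coe_mul]
    rfl
  have hper : ∀ (s : Site P j) (μ : Fin P.d),
      ‖pertVar U (GaugeField.gaugeAct u W) ⟨s, μ⟩‖ ^ 2 - ‖pertVar U W ⟨s, μ⟩‖ ^ 2 =
        (if s = x then -a μ else 0) + (if s = x.unshift μ then -a' μ else 0) := by
    intro s μ
    rw [normSq_pertVar_eq, normSq_pertVar_eq, hcoe]
    by_cases hs : s = x
    · subst hs
      have hshift : s.shift μ ≠ s := fun h' => by
        have h1 := congrFun h' μ
        rw [Site.shift_apply, if_pos rfl] at h1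
        exact B6AvgWeightsKLevelV1.one_ne_zero_sites j (add_eq_left.mp h1)
      rw [if_pos rfl, if_neg (unshift_ne_self s μ).symm, add_zero, hux, hune hshift, ha]
      simp only [OneMemClass.coe_one, star_one, mul_one, sub_mul, one_mul, Matrix.trace_sub, Complex.sub_re, mul_assoc]
      ring
    · rw [if_neg hs, zero_add, hune hs, OneMemClass.coe_one, one_mul]
      by_cases ht : s = x.unshift μ
      · subst ht
        rw [if_pos rfl, Site.shift_unshift, hux, ha']
        have e1 : ((W ⟨x.unshift μ, μ⟩ : Matrix (Fin 2) (Fin 2) ℂ) * star (c : Matrix (Fin 2) (Fin 2) ℂ) *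
            star (U ⟨x.unshift μ, μ⟩ : Matrix (Fin 2) (Fin 2) ℂ)).trace =
            (star (c : Matrix (Fin 2) (Fin 2) ℂ) * (star (U ⟨x.unshift μ, μ⟩ : Matrix (Fin 2) (Fin 2) ℂ) *
              (W ⟨x.unshift μ, μ⟩ : Matrix (Fin 2) (Fin 2) ℂ))).trace := by
          rw [mul_assoc, Matrix.trace_mul_comm, mul_assoc]
        have e2 : ((W ⟨x.unshift μ, μ⟩ : Matrix (Fin 2) (Fin 2) ℂ) * star (U ⟨x.unshift μ, μ⟩ : Matrix (Fin 2) (Fin 2) ℂ)).trace =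
            (star (U ⟨x.unshift μ, μ⟩ : Matrix (Fin 2) (Fin 2) ℂ) * (W ⟨x.unshift μ, μ⟩ : Matrix (Fin 2) (Fin 2) ℂ)).trace :=
          Matrix.trace_mul_comm _ _
        simp only [sub_mul, one_mul, Matrix.trace_sub, Complex.sub_re]
        rw [e1, e2]
        ring
      · have hsx : s.shift μ ≠ x := fun h' => ht (by rw [← h', Site.unshift_shift])
        rw [if_neg ht, hune hsx, OneMemClass.coe_one, star_one, mul_one, sub_self]
  rw [← Finset.sum_sub_distrib, hsum]
  simp only [hper]
  rw [Finset.sum_comm]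
  simp only [Finset.sum_add_distrib, Finset.sum_ite_eq', Finset.mem_univ, if_true, Finset.sum_neg_distrib]
  ring

/-! ## §3 The exact local optimality of the `ℓ²`-optimal representative -/

/-- **THE SLICE INEQUALITY OF THE OPTIMAL CHART, EXACT FORM.**  If `W` is `ℓ²`-optimal on its (4)-orbit relative to `U` (`Prop7CompactChart.exists_optimalRepr` ∕
`chart_optimal`), then at every site `x` that is not a `(K−n)`-fold block centre and for EVERY `c ∈ SU(2)`:
`Σ_μ Re Tr((c − 1)·W(x,μ)U(x,μ)^*) + Σ_μ Re Tr((c^* − 1)·U(x−e_μ,μ)^*W(x−e_μ,μ)) ≤ 0` — `c = 1` maximises the linear function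
`c ↦ Re Tr(c·J₁(x)) + Re Tr(c^*·J₂(x))` over the whole group `SU(2)` (the lattice Landau-gauge functional relative to `U`, one site at a time, off the centres).
[cite: Balaban1985RegularSpaces, (1.19)-(1.20) p.79, (1.38) p.82] -/
theorem optimalRepr_site_ineq (U W : GaugeField (F.P K) 0 (Matrix.specialUnitaryGroup (Fin 2) ℂ))
    (hopt : ∀ v : GaugeTransf (F.P K) 0 (Matrix.specialUnitaryGroup (Fin 2) ℂ), descTransf F n K h v = (fun _ => 1) →
      ∑ b : PBond (F.P K) 0, ‖pertVar U W b‖ ^ 2 ≤ ∑ b : PBond (F.P K) 0, ‖pertVar U (GaugeField.gaugeAct v W) b‖ ^ 2)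
    {x : Site (F.P K) 0} (hx : ∀ y : Site (F.P K) (K - n), embIter (K - n) y ≠ x) (c : Matrix.specialUnitaryGroup (Fin 2) ℂ) :
    (∑ μ : Fin (F.P K).d, ((((c : Matrix (Fin 2) (Fin 2) ℂ) - 1) *
        ((W ⟨x, μ⟩ : Matrix (Fin 2) (Fin 2) ℂ) * star (U ⟨x, μ⟩ : Matrix (Fin 2) (Fin 2) ℂ))).trace).re) +
      ∑ μ : Fin (F.P K).d, (((star (c : Matrix (Fin 2) (Fin 2) ℂ) - 1) *
        (star (U ⟨x.unshift μ, μ⟩ : Matrix (Fin 2) (Fin 2) ℂ) * (W ⟨x.unshift μ, μ⟩ : Matrix (Fin 2) (Fin 2) ℂ))).trace).re ≤ 0 := by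
  have h1 := hopt _ (descTransf_update_one F h hx c)
  have h2 := sum_normSq_pertVar_siteUpdate_sub U W x c
  linarith

/-- **EXISTENCE OF A REPRESENTATIVE IN THE OPTIMAL SLICE** (compactness + the above): every configuration `W′` has a representative `W = W′^{u}`, `u↓ = 1`, on
its (4)-orbit which satisfies the exact slice inequality relative to `U` at every non-centre site, for every `c ∈ SU(2)`. [cite: Balaban1985Variational, Prop. 2 p.281] -/
theorem exists_repr_in_optimalSlice (U W' : GaugeField (F.P K) 0 (Matrix.specialUnitaryGroup (Fin 2) ℂ)) :
    ∃ u : GaugeTransf (F.P K) 0 (Matrix.specialUnitaryGroup (Fin 2) ℂ), descTransf F n K h u = (fun _ => 1) ∧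
      ∀ (x : Site (F.P K) 0), (∀ y : Site (F.P K) (K - n), embIter (K - n) y ≠ x) → ∀ c : Matrix.specialUnitaryGroup (Fin 2) ℂ,
        (∑ μ : Fin (F.P K).d, ((((c : Matrix (Fin 2) (Fin 2) ℂ) - 1) *
            (((GaugeField.gaugeAct u W' ⟨x, μ⟩ : Matrix.specialUnitaryGroup (Fin 2) ℂ) : Matrix (Fin 2) (Fin 2) ℂ) * star (U ⟨x, μ⟩ : Matrix (Fin 2) (Fin 2) ℂ))).trace).re) +
          ∑ μ : Fin (F.P K).d, (((star (c : Matrix (Fin 2) (Fin 2) ℂ) - 1) *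
            (star (U ⟨x.unshift μ, μ⟩ : Matrix (Fin 2) (Fin 2) ℂ) * ((GaugeField.gaugeAct u W' ⟨x.unshift μ, μ⟩ : Matrix.specialUnitaryGroup (Fin 2) ℂ) : Matrix (Fin 2) (Fin 2) ℂ))).trace).re ≤ 0 := by
  obtain ⟨u, hu, hopt⟩ := Prop7CompactChart.chart_optimal F h U W'
  exact ⟨u, hu, fun x hx c => optimalRepr_site_ineq F h U _ hopt hx c⟩

/-! ## §4 The first-order condition along the one-parameter subgroups `exp(tX)`, `X ∈ 𝔰𝔲(2)` -/

/-- `M ↦ Re Tr M` as a continuous `ℝ`-linear functional on `M₂(ℂ)` applied along a curve: the derivative of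
`t ↦ Re Tr((e^{tX} − 1)J₁) + Re Tr((e^{tX})^* − 1)J₂)` at `t = 0` is `Re Tr(XJ₁) + Re Tr(X^*J₂)`. [folklore] -/
theorem hasDerivAt_siteFunctional (X J₁ J₂ : Matrix (Fin 2) (Fin 2) ℂ) :
    HasDerivAt (fun t : ℝ => (((exp (t • X) - 1) * J₁).trace).re + (((star (exp (t • X)) - 1) * J₂).trace).re)
      (((X * J₁).trace).re + ((star X * J₂).trace).re) 0 := by
  have h1 : HasDerivAt (fun t : ℝ => exp (t • X)) X 0 := by
    have := hasDerivAt_exp_smul_const' (𝕂 := ℝ) X (0 : ℝ)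
    simp only [zero_smul, exp_zero, mul_one] at this
    exact this
  have h2 : HasDerivAt (fun t : ℝ => (exp (t • X) - 1) * J₁) (X * J₁) 0 := by
    simpa using (h1.sub_const 1).mul_const J₁
  have h3 : HasDerivAt (fun t : ℝ => (star (exp (t • X)) - 1) * J₂) (star X * J₂) 0 := by
    simpa using (h1.star.sub_const 1).mul_const J₂
  let Φ : Matrix (Fin 2) (Fin 2) ℂ →L[ℝ] ℝ :=
    LinearMap.toContinuousLinearMap (Complex.reLm.comp ((Matrix.traceLinearMap (Fin 2) ℂ ℂ).restrictScalars ℝ))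
  have hΦ : ∀ M : Matrix (Fin 2) (Fin 2) ℂ, Φ M = (M.trace).re := fun M => rfl
  have h4 := (Φ.hasFDerivAt.comp_hasDerivAt (0 : ℝ) h2).add (Φ.hasFDerivAt.comp_hasDerivAt (0 : ℝ) h3)
  simp only [Function.comp_def, hΦ] at h4
  exact h4

/-- **THE SLICE EQUATION OF THE OPTIMAL CHART, INFINITESIMAL FORM («POINT-LANDAU» RELATIVE TO THE BACKGROUND).**  If `W` is `ℓ²`-optimal on its
(4)-orbit relative to `U`, then at every site `x` off the `(K−n)`-fold block centres and for every `X ∈ 𝔰𝔲(2)` (skew-Hermitian, trace zero):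
`Σ_μ Re Tr(X·W(x,μ)U(x,μ)^*) = Σ_μ Re Tr(X·U(x−e_μ,μ)^*W(x−e_μ,μ))` — with `Y = WU^* − 1` and `Re Tr X = 0`: the `𝔰𝔲(2)`-component of the backward
covariant divergence `Σ_{b₋=x} Y_b − Σ_{b₊=x} U_b^*Y_bU_b` vanishes (the lattice Landau gauge relative to `U`, imposed off the centres only).  Proof: the exact
inequality of §3 along `c = exp(tX) ∈ SU(2)` (`Prop8Criticality.exp_smul_mem_su2`) has a maximum at `t = 0`; Fermat. [cite: Balaban1985RegularSpaces, (1.38) p.82] -/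
theorem optimalRepr_site_stationary (U W : GaugeField (F.P K) 0 (Matrix.specialUnitaryGroup (Fin 2) ℂ))
    (hopt : ∀ v : GaugeTransf (F.P K) 0 (Matrix.specialUnitaryGroup (Fin 2) ℂ), descTransf F n K h v = (fun _ => 1) →
      ∑ b : PBond (F.P K) 0, ‖pertVar U W b‖ ^ 2 ≤ ∑ b : PBond (F.P K) 0, ‖pertVar U (GaugeField.gaugeAct v W) b‖ ^ 2)
    {x : Site (F.P K) 0} (hx : ∀ y : Site (F.P K) (K - n), embIter (K - n) y ≠ x)
    {X : Matrix (Fin 2) (Fin 2) ℂ} (hX : X ∈ skewAdjoint (Matrix (Fin 2) (Fin 2) ℂ)) (htr : X.trace = 0) :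
    ∑ μ : Fin (F.P K).d, ((X * ((W ⟨x, μ⟩ : Matrix (Fin 2) (Fin 2) ℂ) * star (U ⟨x, μ⟩ : Matrix (Fin 2) (Fin 2) ℂ))).trace).re =
      ∑ μ : Fin (F.P K).d, ((X * (star (U ⟨x.unshift μ, μ⟩ : Matrix (Fin 2) (Fin 2) ℂ) * (W ⟨x.unshift μ, μ⟩ : Matrix (Fin 2) (Fin 2) ℂ))).trace).re := by
  set J₁ : Matrix (Fin 2) (Fin 2) ℂ := ∑ μ : Fin (F.P K).d, (W ⟨x, μ⟩ : Matrix (Fin 2) (Fin 2) ℂ) * star (U ⟨x, μ⟩ : Matrix (Fin 2) (Fin 2) ℂ) with hJ₁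
  set J₂ : Matrix (Fin 2) (Fin 2) ℂ := ∑ μ : Fin (F.P K).d, star (U ⟨x.unshift μ, μ⟩ : Matrix (Fin 2) (Fin 2) ℂ) * (W ⟨x.unshift μ, μ⟩ : Matrix (Fin 2) (Fin 2) ℂ)
    with hJ₂
  -- the one-parameter subgroup inside `SU(2)` and the exact inequality along it
  let c : ℝ → Matrix.specialUnitaryGroup (Fin 2) ℂ := fun t => ⟨exp (t • X), Prop8Criticality.exp_smul_mem_su2 hX htr t⟩
  set g : ℝ → ℝ := fun t => (((exp (t • X) - 1) * J₁).trace).re + (((star (exp (t • X)) - 1) * J₂).trace).re with hg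
  have hle : ∀ t : ℝ, g t ≤ 0 := fun t => by
    have h1 := optimalRepr_site_ineq F h U W hopt hx (c t)
    have e : ((c t : Matrix.specialUnitaryGroup (Fin 2) ℂ) : Matrix (Fin 2) (Fin 2) ℂ) = exp (t • X) := rfl
    rw [e] at h1
    rw [hg]
    simp only [hJ₁, hJ₂, Finset.mul_sum, Matrix.trace_sum, Complex.re_sum]
    exact h1
  have hg0 : g 0 = 0 := by
    rw [hg]
    simp only [zero_smul, exp_zero, star_one, sub_self, zero_mul, Matrix.trace_zero, Complex.zero_re, add_zero]
  have hmax : IsLocalMax g 0 := Filter.Eventually.of_forall fun t => by rw [hg0]; exact hle t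
  have hder : HasDerivAt g (((X * J₁).trace).re + ((star X * J₂).trace).re) 0 := by
    rw [hg]; exact hasDerivAt_siteFunctional X J₁ J₂
  have h0 := hmax.hasDerivAt_eq_zero hder
  have hXs : star X = -X := hX
  rw [hXs, neg_mul, Matrix.trace_neg, Complex.neg_re, ← sub_eq_add_neg, sub_eq_zero] at h0
  simpa only [hJ₁, hJ₂, Finset.mul_sum, Matrix.trace_sum, Complex.re_sum] using h0

end Summit.QuantumFields.YangMills.Theorems.Prop7OptimalSlice

end
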